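import Summits.QuantumFields.BalabanUV.Beta.GAN24.SrecExitChargeLevelZero

/-!
# `BalabanUV.Beta.GAN24.ExitDefectContourSums` — binder row G-an2-4 ∕ (CONV-C), the (S) row of RULING R-gan24p1-g27-1 B (viii), the Ward-type half (W-γ), EXIT class, jb = 0:
# **THE DEFECT OF THE (γ) EXIT PAIRING VANISHES — `𝒬_L(σ_{1_{B(y)}} ⊙ n) κ w = 0` FOR EVERY 1-FORM `n` WITH `𝒬_L n κ w = 0` WHOSE NON-EXIT `κ`-BONDS CARRY TRANSVERSE VALUES**
# (a finite lattice identity: block label ∕ exit indicator along a straight block contour, one antisymmetric box sum; ENGINE E-leaf06-g46-1 (M3) «sE − R + s2 = 0, sM = 0» as a theorem)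
# (G-an2-4 formalisation swarm → CRUX TEAM (2), seat `b2b-balaban-gan24-formalise-leaf-06` = the (γ) hand, gen 47, INTENT 2 FILE D)

NOT IN PRINT; OUR BOOKKEEPING ([folklore] finite sums on `ℤ^{d+1}`: `Finset.sum_involution` for the box reflection `b_κ ↦ L − 1 − b_κ`; leaf-02's `blk`∕`box` vocabulary; 0 `def`,
0 cited fact, 0 `def … : Prop`, 0 sorry).  HONEST FRAMING (cell contract, verbatim): «discharging `BetaPertH` makes Bałaban's UV stability UNCONDITIONAL — a real constructive-QFT
result; it is NOT the continuum limit and NOT the Clay problem.»  HONEST DEPENDENCY (verbatim): «continuum YM on T⁴ ⇐ BetaPertH ∧ nine spine estimates (0/9 proved); BetaPertH ⇐ (D1) ∧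
(D4) ∧ CAP+tail; G-an2-4 gates asym, D1 and NE2/3/4.»

WHY.  `GaugeReadExitPairing.gaugeRead_exitPairing_gaugeWt` leaves ONE defect: `(cE∕4 − cΛ·wM1_0·(2Lc^{d+1})⁻¹)·Σ'_w Σ_κ 𝒬_{Lc}(σ_{1_{B(y)}} ⊙ n_m) κ w·colM G₀(e) κ w`, `σ_ψ(κ,u) = ψ u + ψ(u+e_κ)`,
`n_m = Π^ρ m − (Lc^{d+1})⁻¹(𝒬m)⊙𝟙^{exit}` (`𝒬 n_m ≡ 0`).  For the comb-free edge potential the non-exit bonds of `n` in direction `κ` carry a value depending only on the coordinates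
transverse to `κ` (`EdgePotentialAxialGauge`); this file proves that these two properties force every block contour sum of `σ_{1_{B(y)}} ⊙ n` to vanish.
* §1 `contourPoint_apply_self ∕ _of_ne`, **`blk_contourPoint`** (`blk L (L•w + b + t•e_κ) = w + [L ≤ b_κ + t]·e_κ`, `b ∈ box`, `b_κ + t < 2L`), **`exit_contourPoint_iff`** (the `t`-th bond is an
  exit bond iff `b_κ + t = L − 1`), `update_contourPoint` (the transverse projection is constant along the contour).
* §2 **`sum_sign_mul_contour`**: with the sign `τ(o) = [o < L−1] − [L ≤ o]`, `Σ_{s<L} τ(b_κ+s)·n κ (L•w + b + s•e_κ) = (L − 1 − 2b_κ)·g(b̄)` for a form with transverse non-exit values `g`.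
* §3 **`sum_box_antisymm_eq_zero`**: `Σ_{b∈box} (L − 1 − 2b_κ)·G b = 0` for `G` blind to `b_κ` (the reflection `b_κ ↦ L−1−b_κ`, `Finset.sum_involution`).
* §4 **`contourSum_bondSum_blockInd_eq_zero`**: `𝒬_L(σ_{1_{B(y)}} ⊙ n) κ w = 0` (the weight along the contour from block `w` is `1 + τ`, `1 − τ` or `0` as `w = y`, `w + e_κ = y`, else;
  the `1` meets `𝒬_L n κ w = 0`, the `τ` gives §2–§3).
Asserts nothing about any table or resolvent; NOTHING of (W-γ) ∕ (INV) ∕ (S) discharged by itself; NEVER «G-an2-4 closed» as (CONV-C); NOT D1, NOT `BetaPertH`, NOT continuum, NOT Clay.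
2026-08-22; no existing file touched.
-/

noncomputable section

open Finset
open scoped BigOperators
open Literature.MathematicalPhysics.QuantumFieldTheory
open Literature.MathematicalPhysics.QuantumFieldTheory.Balaban1983to89
open Literature.MathematicalPhysics.QuantumFieldTheory.Balaban1983to89.Beta
open AffineAveraging (Form0 Form1 box toSite unitVec unitVec_apply dz contourSum)
open AveragingContours (blk blk_block)
open ExpKernelCalculus (Site)

namespace Summit.QuantumFields.BalabanUV.Beta.GAN24.ExitDefectContourSums

variable {d : ℕ}

/-! ## §1 Points of a straight block contour: block label, exit indicator, transverse projection -/

/-- [folklore] The `κ`-coordinate of the `t`-th point of the straight contour from `L•w + b`. -/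
theorem contourPoint_apply_self (L : ℕ) (w : Site (d + 1)) (b : Fin (d + 1) → ℕ) (κ : Fin (d + 1)) (t : ℕ) :
    ((L : ℤ) • w + toSite b + (t : ℤ) • unitVec κ) κ = (L : ℤ) * w κ + ((b κ + t : ℕ) : ℤ) := by
  simp only [Pi.add_apply, Pi.smul_apply, smul_eq_mul, AffineAveraging.toSite, unitVec_apply, if_true, mul_one]
  push_cast; ring

/-- [folklore] The other coordinates do not move. -/
theorem contourPoint_apply_of_ne (L : ℕ) (w : Site (d + 1)) (b : Fin (d + 1) → ℕ) {κ j : Fin (d + 1)} (hj : j ≠ κ) (t : ℕ) :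
    ((L : ℤ) • w + toSite b + (t : ℤ) • unitVec κ) j = (L : ℤ) * w j + (b j : ℤ) := by
  simp only [Pi.add_apply, Pi.smul_apply, smul_eq_mul, AffineAveraging.toSite, unitVec_apply, if_neg hj, mul_zero, add_zero]

/-- [folklore] **THE BLOCK OF A CONTOUR POINT**: for `b ∈ box`, `b_κ + t < 2L`: `blk L (L•w + b + t•e_κ) = w + [L ≤ b_κ + t]·e_κ`. -/
theorem blk_contourPoint {L : ℕ} (hL : 1 ≤ L) (w : Site (d + 1)) {b : Fin (d + 1) → ℕ} (hb : b ∈ box (d + 1) L) (κ : Fin (d + 1)) {t : ℕ}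
    (ht : b κ + t < 2 * L) :
    blk L ((L : ℤ) • w + toSite b + (t : ℤ) • unitVec κ) = w + (if L ≤ b κ + t then unitVec κ else 0) := by
  have hL0 : (0 : ℤ) < L := by exact_mod_cast hL
  have hbj : ∀ j, b j < L := fun j => Finset.mem_range.1 (Fintype.mem_piFinset.1 hb j)
  funext j
  show ((L : ℤ) • w + toSite b + (t : ℤ) • unitVec κ) j / (L : ℤ) = (w + (if L ≤ b κ + t then unitVec κ else 0)) j
  by_cases hj : j = κ
  · subst hj
    rw [contourPoint_apply_self, add_comm ((L : ℤ) * w j), Int.add_mul_ediv_left _ _ (ne_of_gt hL0)]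
    split_ifs with h
    · have e : ((b j + t : ℕ) : ℤ) / (L : ℤ) = 1 := by
        rw [Int.ediv_eq_iff_of_pos hL0]
        constructor
        · rw [one_mul]; exact_mod_cast (by omega : L ≤ b j + t)
        · rw [one_mul]; exact_mod_cast (by omega : b j + t < L + L)
      rw [e]; simp [add_comm]
    · have e : ((b j + t : ℕ) : ℤ) / (L : ℤ) = 0 := Int.ediv_eq_zero_of_lt (by positivity) (by exact_mod_cast (by omega : b j + t < L))
      rw [e]; simp
  · rw [contourPoint_apply_of_ne L w b hj, add_comm ((L : ℤ) * w j), Int.add_mul_ediv_left _ _ (ne_of_gt hL0),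
      Int.ediv_eq_zero_of_lt (by positivity) (by exact_mod_cast hbj j), zero_add]
    split_ifs
    · simp [unitVec_apply, hj]
    · simp

/-- [folklore] **THE EXIT INDICATOR ALONG A CONTOUR**: for `b ∈ box`, `t < L`: the `t`-th point is the base of an exit bond iff `b_κ + t = L − 1`. -/
theorem exit_contourPoint_iff {L : ℕ} (hL : 1 ≤ L) (w : Site (d + 1)) {b : Fin (d + 1) → ℕ} (hb : b ∈ box (d + 1) L) (κ : Fin (d + 1)) {t : ℕ} (ht : t < L) :
    ((L : ℤ) • w + toSite b + (t : ℤ) • unitVec κ) κ % (L : ℤ) = (L : ℤ) - 1 ↔ b κ + t = L - 1 := by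
  have hL0 : (0 : ℤ) < L := by exact_mod_cast hL
  have hbκ : b κ < L := Finset.mem_range.1 (Fintype.mem_piFinset.1 hb κ)
  rw [contourPoint_apply_self, add_comm ((L : ℤ) * w κ), Int.add_mul_emod_self_left]
  by_cases hlt : b κ + t < L
  · rw [Int.emod_eq_of_lt (by positivity) (by exact_mod_cast hlt)]
    constructor
    · intro h; have : ((b κ + t : ℕ) : ℤ) = ((L - 1 : ℕ) : ℤ) := by rw [h]; push_cast [hL]; ring
      exact_mod_cast this
    · intro h; rw [h]; push_cast [hL]; ring
  · have hge : L ≤ b κ + t := not_lt.1 hlt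
    have e3 : ((b κ + t : ℕ) : ℤ) = ((b κ + t - L : ℕ) : ℤ) + 1 * (L : ℤ) := by push_cast [hge]; ring
    rw [e3, Int.add_mul_emod_self_right, Int.emod_eq_of_lt (by positivity) (by exact_mod_cast (by omega : b κ + t - L < L))]
    constructor
    · intro h; exfalso
      have : ((b κ + t - L : ℕ) : ℤ) < (L : ℤ) - 1 := by
        have : b κ + t - L < L - 1 := by omega
        have := (Int.ofNat_lt.2 this); push_cast [hL] at this; linarith
      linarith
    · intro h; omega

/-- [folklore] The transverse projection of a contour point does not depend on the position along the contour. -/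
theorem update_contourPoint (L : ℕ) (w : Site (d + 1)) (b : Fin (d + 1) → ℕ) (κ : Fin (d + 1)) (t : ℕ) :
    Function.update ((L : ℤ) • w + toSite b + (t : ℤ) • unitVec κ) κ 0 = Function.update ((L : ℤ) • w + toSite b) κ 0 := by
  funext j
  by_cases hj : j = κ
  · subst hj; simp
  · simp only [Function.update_of_ne hj, Pi.add_apply, Pi.smul_apply, unitVec_apply, if_neg hj, smul_zero, add_zero]

/-! ## §2 One contour: a form whose interior values are transverse has an antisymmetric signed sum -/

/-- [folklore] **THE SIGNED SUM ALONG ONE CONTOUR** (`b ∈ box`, `1 ≤ L`): if the NON-EXIT `κ`-bonds of `n` take a value depending only on the transverse coordinates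
(`n κ z = g (update z κ 0)` whenever `z_κ % L ≠ L − 1`), then `Σ_{s<L} τ(b_κ + s)·n κ (L•w + b + s•e_κ) = (L − 1 − 2b_κ)·g(b̄)`, with the sign `τ(o) = [o < L−1] − [L ≤ o]`
(`+1` inside the block, `0` on the exit bond, `−1` beyond it) and `b̄ = update (L•w + b) κ 0`. -/
theorem sum_sign_mul_contour {L : ℕ} (hL : 1 ≤ L) (w : Site (d + 1)) {b : Fin (d + 1) → ℕ} (hb : b ∈ box (d + 1) L) (κ : Fin (d + 1))
    {n : Form1 (d + 1) ℝ} {g : Site (d + 1) → ℝ} (hn : ∀ z : Site (d + 1), z κ % (L : ℤ) ≠ (L : ℤ) - 1 → n κ z = g (Function.update z κ 0)) :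
    ∑ s ∈ Finset.range L, ((if b κ + s < L - 1 then (1 : ℝ) else 0) - (if L ≤ b κ + s then (1 : ℝ) else 0))
        * n κ ((L : ℤ) • w + toSite b + (s : ℤ) • unitVec κ)
      = ((L : ℝ) - 1 - 2 * (b κ : ℝ)) * g (Function.update ((L : ℤ) • w + toSite b) κ 0) := by
  classical
  have hbκ : b κ < L := Finset.mem_range.1 (Fintype.mem_piFinset.1 hb κ)
  have e : ∀ s ∈ Finset.range L, ((if b κ + s < L - 1 then (1 : ℝ) else 0) - (if L ≤ b κ + s then (1 : ℝ) else 0))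
        * n κ ((L : ℤ) • w + toSite b + (s : ℤ) • unitVec κ)
      = ((if b κ + s < L - 1 then (1 : ℝ) else 0) - (if L ≤ b κ + s then (1 : ℝ) else 0)) * g (Function.update ((L : ℤ) • w + toSite b) κ 0) := by
    intro s hs
    have hsL : s < L := Finset.mem_range.1 hs
    by_cases ho : b κ + s = L - 1
    · have h1 : ¬ (b κ + s < L - 1) := by omega
      have h2 : ¬ (L ≤ b κ + s) := by omega
      rw [if_neg h1, if_neg h2, sub_zero, zero_mul, zero_mul]
    · have hne : ((L : ℤ) • w + toSite b + (s : ℤ) • unitVec κ) κ % (L : ℤ) ≠ (L : ℤ) - 1 :=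
        fun h => ho ((exit_contourPoint_iff hL w hb κ hsL).1 h)
      rw [hn _ hne, update_contourPoint]
  rw [Finset.sum_congr rfl e, ← Finset.sum_mul, Finset.sum_sub_distrib, Finset.sum_boole, Finset.sum_boole]
  have c1 : ((Finset.range L).filter (fun s => b κ + s < L - 1)) = Finset.range (L - 1 - b κ) := by
    ext s; simp only [Finset.mem_filter, Finset.mem_range]; omega
  have c2 : ((Finset.range L).filter (fun s => L ≤ b κ + s)) = Finset.Ico (L - b κ) L := by
    ext s; simp only [Finset.mem_filter, Finset.mem_range, Finset.mem_Ico]; omega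
  rw [c1, c2, Finset.card_range, Nat.card_Ico]
  have e1 : (((L - 1 - b κ : ℕ)) : ℝ) = (L : ℝ) - 1 - b κ := by
    rw [Nat.cast_sub (by omega), Nat.cast_sub hL]; push_cast; ring
  have e2 : (((L - (L - b κ) : ℕ)) : ℝ) = (b κ : ℝ) := by
    rw [show L - (L - b κ) = b κ by omega]
  rw [e1, e2]
  ring

/-! ## §3 The box reflection along `κ` and the vanishing of the antisymmetric sum -/

/-- [folklore] **THE ANTISYMMETRIC BOX SUM VANISHES**: `Σ_{b ∈ box} (L − 1 − 2b_κ)·G(b) = 0` whenever `G` is blind to the `κ`-coordinate (`G b = G (update b κ c)` for all `c`) —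
the reflection `b_κ ↦ L − 1 − b_κ` is an involution of the box reversing the sign (`Finset.sum_involution`). -/
theorem sum_box_antisymm_eq_zero (L : ℕ) (κ : Fin (d + 1)) {G : (Fin (d + 1) → ℕ) → ℝ} (hG : ∀ b c, G (Function.update b κ c) = G b) :
    ∑ b ∈ box (d + 1) L, ((L : ℝ) - 1 - 2 * (b κ : ℝ)) * G b = 0 := by
  classical
  refine Finset.sum_involution (fun b _ => Function.update b κ (L - 1 - b κ)) ?_ ?_ ?_ ?_
  · intro b hb
    have hbκ : b κ < L := Finset.mem_range.1 (Fintype.mem_piFinset.1 hb κ)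
    rw [hG, Function.update_self]
    have e1 : (((L - 1 - b κ : ℕ)) : ℝ) = (L : ℝ) - 1 - b κ := by
      rw [Nat.cast_sub (by omega), Nat.cast_sub (by omega)]; push_cast; ring
    rw [e1]; ring
  · intro b hb hne heq
    have hbκ : b κ < L := Finset.mem_range.1 (Fintype.mem_piFinset.1 hb κ)
    have h := congrArg (fun f => f κ) heq
    simp only [Function.update_self] at h
    apply hne
    have e : ((L : ℝ) - 1 - 2 * (b κ : ℝ)) = 0 := by
      have h2 : (((L - 1 - b κ : ℕ)) : ℝ) = (b κ : ℝ) := by exact_mod_cast h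
      rw [Nat.cast_sub (by omega), Nat.cast_sub (by omega)] at h2; push_cast at h2; linarith
    rw [e, zero_mul]
  · intro b hb
    have hbκ : b κ < L := Finset.mem_range.1 (Fintype.mem_piFinset.1 hb κ)
    rw [AffineAveraging.box, Fintype.mem_piFinset] at hb ⊢
    intro j
    by_cases hj : j = κ
    · subst hj; rw [Function.update_self, Finset.mem_range]; omega
    · rw [Function.update_of_ne hj]; exact hb j
  · intro b hb
    have hbκ : b κ < L := Finset.mem_range.1 (Fintype.mem_piFinset.1 hb κ)
    funext j
    by_cases hj : j = κ
    · subst hj; simp only [Function.update_self]; omega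
    · simp only [Function.update_of_ne hj]

/-! ## §4 The block contour sums of `σ_{1_B(y)} ⊙ n` vanish -/

/-- NOT IN PRINT; OUR BOOKKEEPING.  **THE BLOCK CONTOUR SUMS OF THE BOND-SUM-WEIGHTED FORM VANISH** (`1 ≤ L`; direction `κ`, block `w`, label `y`): if the block contour sum
`𝒬_L n κ w` vanishes and the non-exit `κ`-bonds of `n` carry a value depending only on the transverse coordinates, then
`𝒬_L(σ_{1_{B(y)}} ⊙ n) κ w = Σ_{b∈box} Σ_{s<L} (1_{B(y)}(u) + 1_{B(y)}(u + e_κ))·n κ u |_{u = L•w + b + s•e_κ} = 0`.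
(Along each contour the weight is `1 + τ`, `1 − τ` or `0` according as `w = y`, `w + e_κ = y` or neither — §1; the `1` meets `𝒬_L n κ w = 0`, the `τ` gives the antisymmetric box sum of §2–§3.)
This is ENGINE E-leaf06-g46-1 (M3)'s cancellation «sE − R + s2 = 0, sM = 0» as a lattice identity, for every form with these two properties. -/
theorem contourSum_bondSum_blockInd_eq_zero {L : ℕ} (hL : 1 ≤ L) (κ : Fin (d + 1)) (w y : Site (d + 1)) {n : Form1 (d + 1) ℝ} {g : Site (d + 1) → ℝ}
    (hn : ∀ z : Site (d + 1), z κ % (L : ℤ) ≠ (L : ℤ) - 1 → n κ z = g (Function.update z κ 0)) (hq : contourSum L n κ w = 0) :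
    contourSum L (fun κ' u => ((if blk L u = y then (1 : ℝ) else 0) + (if blk L (u + unitVec κ') = y then (1 : ℝ) else 0)) * n κ' u) κ w = 0 := by
  classical
  simp only [AffineAveraging.contourSum] at hq ⊢
  -- the weight along the contour from `L•w + b`
  have hwt : ∀ b ∈ box (d + 1) L, ∀ s ∈ Finset.range L,
      ((if blk L ((L : ℤ) • w + toSite b + (s : ℤ) • unitVec κ) = y then (1 : ℝ) else 0)
        + (if blk L ((L : ℤ) • w + toSite b + (s : ℤ) • unitVec κ + unitVec κ) = y then (1 : ℝ) else 0))
      = (if w = y then (1 : ℝ) + ((if b κ + s < L - 1 then (1 : ℝ) else 0) - (if L ≤ b κ + s then (1 : ℝ) else 0)) else 0)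
        + (if w + unitVec κ = y then (1 : ℝ) - ((if b κ + s < L - 1 then (1 : ℝ) else 0) - (if L ≤ b κ + s then (1 : ℝ) else 0)) else 0) := by
    intro b hb s hs
    have hsL : s < L := Finset.mem_range.1 hs
    have hbκ : b κ < L := Finset.mem_range.1 (Fintype.mem_piFinset.1 hb κ)
    have e1 := blk_contourPoint hL w hb κ (t := s) (by omega)
    have e2' : (L : ℤ) • w + toSite b + (s : ℤ) • unitVec κ + unitVec κ = (L : ℤ) • w + toSite b + ((s + 1 : ℕ) : ℤ) • unitVec κ := by
      push_cast; rw [add_smul, one_smul, add_assoc]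
    have e2 := blk_contourPoint hL w hb κ (t := s + 1) (by omega)
    rw [e2'] ; rw [e1, e2]
    by_cases h1 : L ≤ b κ + s
    · have h2 : L ≤ b κ + (s + 1) := by omega
      have h3 : ¬ (b κ + s < L - 1) := by omega
      simp only [if_pos h1, if_pos h2, if_neg h3]
      split_ifs <;> norm_num
    · by_cases h2 : L ≤ b κ + (s + 1)
      · have h3 : ¬ (b κ + s < L - 1) := by omega
        simp only [if_neg h1, if_pos h2, if_neg h3, add_zero]
        split_ifs <;> norm_num
      · have h3 : b κ + s < L - 1 := by omega
        simp only [if_neg h1, if_neg h2, if_pos h3, add_zero]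
        split_ifs <;> norm_num
  -- regroup: constant part meets `𝒬_L n κ w = 0`, signed part is antisymmetric
  have hsplit : ∀ b ∈ box (d + 1) L, (∑ s ∈ Finset.range L,
      ((if blk L ((L : ℤ) • w + toSite b + (s : ℤ) • unitVec κ) = y then (1 : ℝ) else 0)
        + (if blk L ((L : ℤ) • w + toSite b + (s : ℤ) • unitVec κ + unitVec κ) = y then (1 : ℝ) else 0))
        * n κ ((L : ℤ) • w + toSite b + (s : ℤ) • unitVec κ))
      = ((if w = y then (1 : ℝ) else 0) + (if w + unitVec κ = y then (1 : ℝ) else 0)) * ∑ s ∈ Finset.range L, n κ ((L : ℤ) • w + toSite b + (s : ℤ) • unitVec κ)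
        + ((if w = y then (1 : ℝ) else 0) - (if w + unitVec κ = y then (1 : ℝ) else 0))
          * (((L : ℝ) - 1 - 2 * (b κ : ℝ)) * g (Function.update ((L : ℤ) • w + toSite b) κ 0)) := by
    intro b hb
    rw [← sum_sign_mul_contour hL w hb κ hn, Finset.mul_sum, Finset.mul_sum, ← Finset.sum_add_distrib]
    refine Finset.sum_congr rfl fun s hs => ?_
    rw [hwt b hb s hs]
    split_ifs <;> ring
  rw [Finset.sum_congr rfl hsplit, Finset.sum_add_distrib, ← Finset.mul_sum, ← Finset.mul_sum, hq, mul_zero, zero_add]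
  have hG : ∀ (b : Fin (d + 1) → ℕ) (c : ℕ), g (Function.update ((L : ℤ) • w + toSite (Function.update b κ c)) κ 0)
      = g (Function.update ((L : ℤ) • w + toSite b) κ 0) := by
    intro b c
    congr 1
    funext j
    by_cases hj : j = κ
    · subst hj; simp
    · simp [Function.update_of_ne hj, AffineAveraging.toSite]
  rw [sum_box_antisymm_eq_zero L κ hG, mul_zero]

end Summit.QuantumFields.BalabanUV.Beta.GAN24.ExitDefectContourSums

end
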